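import Mathlib
import Summits.NavierStokesRegularity.NavierStokesRegularity.Theorems.FrozenSignCascadeEnvelopeBoundSmallDataKernel
import Literature.Analysis.FluidPDE.NSFourierAPriori
import HarnessLib

/-!
# Route FrozenSignCascade · crux `EnvelopeBound` (stmt-NavierStokesRegularity-1549), line
  `registered` (reshape r3): stub `stub_agmonL1` — the Fourier-side Agmon inequality

Support file for the crux item stmt-NavierStokesRegularity-1549 (`EnvelopeBound`); lands
`--supports` that item (stub `stub_agmonL1` of the line `registered`, reshape r3).

**Theorem (`stub_agmonL1`).** There is an absolute constant `K₂ ≥ 0` (here `K₂ = (3|B₁|)^{1/2}`,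
`|B₁|` the volume of the unit ball of `ℝ³`) such that for every continuous coefficient field
`v : ℝ³ → ℂ³` with decay of every polynomial order and every frequency radius `ρ > 0`,

  `∫ ‖v(ξ)‖ dξ ≤ K₂ · (ρ^{1/2} · Ens^{1/2} + ρ^{-1/2} · D^{1/2})`,

where `Ens = ∫ ‖ξ‖² ∑ₗ ‖v(ξ)ₗ‖²` (Fourier enstrophy) and `D = ∫ ‖ξ‖⁴ ∑ₗ ‖v(ξ)ₗ‖²` (Fourier
dissipation of the enstrophy). Optimising `ρ = (D/Ens)^{1/2}` gives the Fourier form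
`‖v‖_{L¹} ≲ Ens^{1/4} D^{1/4}` of Agmon's inequality `‖u‖_∞ ≲ ‖∇u‖₂^{1/2} ‖Δu‖₂^{1/2}` on `ℝ³`.

Proof. Split `∫ ‖v‖` at the radius `ρ` (`integral_add_compl`). On the ball, Cauchy–Schwarz
(`sq_integral_mul_le_of_integrable`) with the weight `‖ξ‖⁻¹ · (‖ξ‖‖v‖)` (the factorisation holds
off the origin, a null set) and the radial integral `∫_{‖ξ‖<ρ} ‖ξ‖⁻² ≤ 3|B₁| ρ`
(`Registered.integral_ball_inv_norm_sq_le`); on the tail, Cauchy–Schwarz with the weight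
`‖ξ‖⁻² · (‖ξ‖²‖v‖)` and `∫_{‖ξ‖≥ρ} ‖ξ‖⁻⁴ ≤ 3|B₁| ρ⁻¹` (`Registered.integral_tail_inv_norm_four_le`).
Finally `‖v(ξ)‖² ≤ ∑ₗ ‖v(ξ)ₗ‖²` for the sup norm on `ℂ³`, and square roots are rewritten as
`rpow (1/2)`. Integrability of every density comes from the all-order decay.

References: S. Agmon, *Lectures on elliptic boundary value problems* (1965), §13 (the interpolation
inequality); P. Constantin, C. Foias, *Navier–Stokes equations* (1988), Ch. 9 (Leray's enstrophy
argument); P. G. Lemarié-Rieusset, *The Navier–Stokes problem in the 21st century* (2016), §8.5.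
-/

noncomputable section

set_option linter.dupNamespace false -- nested layout Summit.<S>.<Sub>, Sub = S (D-0017)

open MeasureTheory Set Metric Real Filter Topology
open Literature.Analysis.FluidPDE Literature.Analysis.FluidPDE.FourierNS
open Summit.NavierStokesRegularity.NavierStokesRegularity.Theorems.EnvelopeBound.Registered

namespace Summit.NavierStokesRegularity.NavierStokesRegularity.Theorems.EnvelopeBound.Leray

/-! ### Pointwise and integrability preliminaries -/

/-- For the sup norm on `ℂ³` (indeed on any finite product): `‖z‖² ≤ ∑ₗ ‖z l‖²`. -/
theorem pi_norm_sq_le_sum_norm_sq (z : Fin 3 → ℂ) : ‖z‖ ^ 2 ≤ ∑ l, ‖z l‖ ^ 2 := by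
  have hS : 0 ≤ ∑ l, ‖z l‖ ^ 2 := Finset.sum_nonneg fun l _ => sq_nonneg _
  have h : ‖z‖ ≤ Real.sqrt (∑ l, ‖z l‖ ^ 2) := by
    refine (pi_norm_le_iff_of_nonneg (Real.sqrt_nonneg _)).2 fun l => ?_
    rw [← Real.sqrt_sq (norm_nonneg (z l))]
    exact Real.sqrt_le_sqrt (Finset.single_le_sum (f := fun l => ‖z l‖ ^ 2)
      (fun l _ => sq_nonneg _) (Finset.mem_univ l))
  calc ‖z‖ ^ 2 ≤ (Real.sqrt (∑ l, ‖z l‖ ^ 2)) ^ 2 := pow_le_pow_left₀ (norm_nonneg _) h 2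
    _ = ∑ l, ‖z l‖ ^ 2 := Real.sq_sqrt hS

/-- For the sup norm on `ℂ³`: `∑ₗ ‖z l‖² ≤ 3 ‖z‖²` (each `‖z l‖ ≤ ‖z‖`). -/
theorem sum_norm_sq_le_three_mul (z : Fin 3 → ℂ) : ∑ l, ‖z l‖ ^ 2 ≤ 3 * ‖z‖ ^ 2 := by
  calc ∑ l, ‖z l‖ ^ 2 ≤ ∑ _l : Fin 3, ‖z‖ ^ 2 :=
        Finset.sum_le_sum fun l _ => pow_le_pow_left₀ (norm_nonneg _) (norm_le_pi_norm z l) 2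
    _ = 3 * ‖z‖ ^ 2 := by simp

/-- `‖η‖² ‖f‖²` is integrable as soon as `‖f‖²` and `‖η‖⁴ ‖f‖²` are (`‖η‖² ≤ 1 + ‖η‖⁴`). -/
theorem integrable_norm_sq_mul_norm_sq {F : Type*} [NormedAddCommGroup F]
    {f : EuclideanSpace ℝ (Fin 3) → F} (hfm : AEStronglyMeasurable f volume)
    (h0 : Integrable fun η => ‖f η‖ ^ 2) (h4 : Integrable fun η => ‖η‖ ^ 4 * ‖f η‖ ^ 2) :
    Integrable fun η => ‖η‖ ^ 2 * ‖f η‖ ^ 2 := by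
  refine (h0.add h4).mono' ((continuous_norm.pow 2).aestronglyMeasurable.mul (hfm.norm.pow 2))
    (Eventually.of_forall fun η => ?_)
  rw [Real.norm_of_nonneg (by positivity), Pi.add_apply]
  have h : ‖η‖ ^ 2 ≤ 1 + ‖η‖ ^ 4 := by nlinarith [sq_nonneg (‖η‖ ^ 2 - 1), sq_nonneg ‖η‖]
  calc ‖η‖ ^ 2 * ‖f η‖ ^ 2 ≤ (1 + ‖η‖ ^ 4) * ‖f η‖ ^ 2 :=
        mul_le_mul_of_nonneg_right h (sq_nonneg _)
    _ = ‖f η‖ ^ 2 + ‖η‖ ^ 4 * ‖f η‖ ^ 2 := by ring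

/-- Integrability of the componentwise density `‖ξ‖^m ∑ₗ ‖v ξ l‖²` from that of `‖ξ‖^m ‖v ξ‖²`
(`∑ₗ ‖v ξ l‖² ≤ 3 ‖v ξ‖²`). -/
theorem integrable_pow_mul_sum_norm_sq {v : EuclideanSpace ℝ (Fin 3) → Fin 3 → ℂ}
    (hvc : Continuous v) {m : ℕ} (h : Integrable fun ξ => ‖ξ‖ ^ m * ‖v ξ‖ ^ 2) :
    Integrable fun ξ => ‖ξ‖ ^ m * ∑ l, ‖v ξ l‖ ^ 2 := by
  refine (h.const_mul 3).mono' ?_ (Eventually.of_forall fun ξ => ?_)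
  · exact (by fun_prop : Continuous fun ξ : EuclideanSpace ℝ (Fin 3) =>
      ‖ξ‖ ^ m * ∑ l, ‖v ξ l‖ ^ 2).aestronglyMeasurable
  · rw [Real.norm_of_nonneg (by positivity)]
    calc ‖ξ‖ ^ m * ∑ l, ‖v ξ l‖ ^ 2 ≤ ‖ξ‖ ^ m * (3 * ‖v ξ‖ ^ 2) :=
          mul_le_mul_of_nonneg_left (sum_norm_sq_le_three_mul (v ξ)) (by positivity)
      _ = 3 * (‖ξ‖ ^ m * ‖v ξ‖ ^ 2) := by ring

/-! ### Cauchy–Schwarz on the ball and on the tail -/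

/-- **The low frequencies.** For `ρ > 0` and an integrable `v` with `‖ξ‖² ‖v‖²` integrable,
`(∫_{‖ξ‖<ρ} ‖v‖)² ≤ 3|B₁| ρ · ∫ ‖ξ‖² ‖v‖²`: Cauchy–Schwarz with `‖v‖ = ‖ξ‖⁻¹ · (‖ξ‖ ‖v‖)` off the
origin and `∫_{‖ξ‖<ρ} ‖ξ‖⁻² ≤ 3|B₁| ρ`. -/
theorem sq_setIntegral_ball_norm_le {v : EuclideanSpace ℝ (Fin 3) → Fin 3 → ℂ}
    (hvi : Integrable v) (h2 : Integrable fun η => ‖η‖ ^ 2 * ‖v η‖ ^ 2) {ρ : ℝ} (hρ : 0 < ρ) :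
    (∫ η in ball (0 : EuclideanSpace ℝ (Fin 3)) ρ, ‖v η‖) ^ 2 ≤
      (3 * (volume (ball (0 : EuclideanSpace ℝ (Fin 3)) 1)).toReal * ρ) *
        ∫ η, ‖η‖ ^ 2 * ‖v η‖ ^ 2 := by
  set B := ball (0 : EuclideanSpace ℝ (Fin 3)) ρ with hB
  have hBm : MeasurableSet B := measurableSet_ball
  -- off the origin (a null set): `‖v η‖ = ‖η‖⁻¹ (‖η‖ ‖v η‖)`
  have hae : ∀ᵐ η ∂(volume.restrict B), ‖v η‖ = ‖η‖⁻¹ * (‖η‖ * ‖v η‖) := by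
    refine ae_restrict_of_ae ?_
    filter_upwards [Measure.ae_ne volume (0 : EuclideanSpace ℝ (Fin 3))] with η hη
    have hη' : ‖η‖ ≠ 0 := norm_ne_zero_iff.2 hη
    rw [← mul_assoc, inv_mul_cancel₀ hη', one_mul]
  have hf2 : Integrable (fun η : EuclideanSpace ℝ (Fin 3) => ‖η‖⁻¹ ^ 2) (volume.restrict B) :=
    (integrableOn_inv_norm_sq_ball ρ).congr_fun (fun η _ => by rw [inv_pow]) hBm
  have hg2 : Integrable (fun η : EuclideanSpace ℝ (Fin 3) => (‖η‖ * ‖v η‖) ^ 2)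
      (volume.restrict B) :=
    (h2.congr (Eventually.of_forall fun η => by simp only; ring)).integrableOn
  have hfg : Integrable (fun η : EuclideanSpace ℝ (Fin 3) => ‖η‖⁻¹ * (‖η‖ * ‖v η‖))
      (volume.restrict B) :=
    (hvi.norm.integrableOn (s := B)).integrable.congr hae
  have hcs := sq_integral_mul_le_of_integrable (μ := volume.restrict B)
    (f := fun η => ‖η‖⁻¹) (g := fun η => ‖η‖ * ‖v η‖) hf2 hg2 hfg
  have hI1 : ∫ η in B, ‖η‖⁻¹ ^ 2 ≤ 3 * (volume (ball (0 : EuclideanSpace ℝ (Fin 3)) 1)).toReal * ρ := by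
    have e : ∫ η in B, ‖η‖⁻¹ ^ 2 = ∫ η, B.indicator (fun ζ => (‖ζ‖ ^ 2)⁻¹) η := by
      rw [integral_indicator hBm]
      exact setIntegral_congr_fun hBm fun η _ => by rw [inv_pow]
    rw [e]
    exact integral_ball_inv_norm_sq_le hρ.le
  have hI2 : ∫ η in B, (‖η‖ * ‖v η‖) ^ 2 ≤ ∫ η, ‖η‖ ^ 2 * ‖v η‖ ^ 2 := by
    calc ∫ η in B, (‖η‖ * ‖v η‖) ^ 2 = ∫ η in B, ‖η‖ ^ 2 * ‖v η‖ ^ 2 :=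
          integral_congr_ae (Eventually.of_forall fun η => by simp only; ring)
      _ ≤ ∫ η, ‖η‖ ^ 2 * ‖v η‖ ^ 2 :=
          setIntegral_le_integral h2 (Eventually.of_forall fun η => by positivity)
  have hI20 : 0 ≤ ∫ η in B, (‖η‖ * ‖v η‖) ^ 2 := integral_nonneg fun η => sq_nonneg _
  calc (∫ η in B, ‖v η‖) ^ 2 = (∫ η in B, ‖η‖⁻¹ * (‖η‖ * ‖v η‖)) ^ 2 := by
        rw [integral_congr_ae hae]
    _ ≤ (∫ η in B, ‖η‖⁻¹ ^ 2) * ∫ η in B, (‖η‖ * ‖v η‖) ^ 2 := hcs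
    _ ≤ (3 * (volume (ball (0 : EuclideanSpace ℝ (Fin 3)) 1)).toReal * ρ) *
          ∫ η, ‖η‖ ^ 2 * ‖v η‖ ^ 2 := mul_le_mul hI1 hI2 hI20 (by positivity)

/-- **The high frequencies.** For `ρ > 0` and an integrable `v` with `‖ξ‖⁴ ‖v‖²` integrable,
`(∫_{‖ξ‖≥ρ} ‖v‖)² ≤ 3|B₁| ρ⁻¹ · ∫ ‖ξ‖⁴ ‖v‖²`: Cauchy–Schwarz with `‖v‖ = ‖ξ‖⁻² · (‖ξ‖² ‖v‖)` on
the tail and `∫_{‖ξ‖≥ρ} ‖ξ‖⁻⁴ ≤ 3|B₁| ρ⁻¹`. -/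
theorem sq_setIntegral_tail_norm_le {v : EuclideanSpace ℝ (Fin 3) → Fin 3 → ℂ}
    (hvi : Integrable v) (h4 : Integrable fun η => ‖η‖ ^ 4 * ‖v η‖ ^ 2) {ρ : ℝ} (hρ : 0 < ρ) :
    (∫ η in (ball (0 : EuclideanSpace ℝ (Fin 3)) ρ)ᶜ, ‖v η‖) ^ 2 ≤
      (3 * (volume (ball (0 : EuclideanSpace ℝ (Fin 3)) 1)).toReal * ρ⁻¹) *
        ∫ η, ‖η‖ ^ 4 * ‖v η‖ ^ 2 := by
  set T := (ball (0 : EuclideanSpace ℝ (Fin 3)) ρ)ᶜ with hT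
  have hTeq : T = {η : EuclideanSpace ℝ (Fin 3) | ρ ≤ ‖η‖} := by
    ext η
    simp [hT, not_lt]
  have hTm : MeasurableSet T := measurableSet_ball.compl
  have hmem : ∀ η ∈ T, ‖η‖ ^ 2 ≠ 0 := fun η hη => by
    have : ρ ≤ ‖η‖ := by rw [hTeq] at hη; exact hη
    exact pow_ne_zero 2 (by linarith)
  -- on the tail: `‖v η‖ = ‖η‖⁻² (‖η‖² ‖v η‖)`
  have hpt : EqOn (fun η => ‖v η‖) (fun η => (‖η‖ ^ 2)⁻¹ * (‖η‖ ^ 2 * ‖v η‖)) T := fun η hη => by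
    simp only
    rw [← mul_assoc, inv_mul_cancel₀ (hmem η hη), one_mul]
  have hf2 : Integrable (fun η : EuclideanSpace ℝ (Fin 3) => (‖η‖ ^ 2)⁻¹ ^ 2)
      (volume.restrict T) := by
    have hi := integrable_tail_inv_norm_four hρ
    rw [← hTeq, integrable_indicator_iff hTm] at hi
    exact hi.congr_fun (fun η _ => by rw [inv_pow, ← pow_mul]) hTm
  have hg2 : Integrable (fun η : EuclideanSpace ℝ (Fin 3) => (‖η‖ ^ 2 * ‖v η‖) ^ 2)
      (volume.restrict T) :=
    (h4.congr (Eventually.of_forall fun η => by simp only; ring)).integrableOn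
  have hfg : Integrable (fun η : EuclideanSpace ℝ (Fin 3) => (‖η‖ ^ 2)⁻¹ * (‖η‖ ^ 2 * ‖v η‖))
      (volume.restrict T) :=
    (hvi.norm.integrableOn (s := T)).congr_fun hpt hTm
  have hcs := sq_integral_mul_le_of_integrable (μ := volume.restrict T)
    (f := fun η => (‖η‖ ^ 2)⁻¹) (g := fun η => ‖η‖ ^ 2 * ‖v η‖) hf2 hg2 hfg
  have hI1 : ∫ η in T, (‖η‖ ^ 2)⁻¹ ^ 2 ≤
      3 * (volume (ball (0 : EuclideanSpace ℝ (Fin 3)) 1)).toReal * ρ⁻¹ := by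
    have e : ∫ η in T, (‖η‖ ^ 2)⁻¹ ^ 2 =
        ∫ η, {η : EuclideanSpace ℝ (Fin 3) | ρ ≤ ‖η‖}.indicator (fun η => (‖η‖ ^ 4)⁻¹) η := by
      rw [← hTeq, integral_indicator hTm]
      exact setIntegral_congr_fun hTm fun η _ => by rw [inv_pow, ← pow_mul]
    rw [e]
    exact integral_tail_inv_norm_four_le hρ
  have hI2 : ∫ η in T, (‖η‖ ^ 2 * ‖v η‖) ^ 2 ≤ ∫ η, ‖η‖ ^ 4 * ‖v η‖ ^ 2 := by
    calc ∫ η in T, (‖η‖ ^ 2 * ‖v η‖) ^ 2 = ∫ η in T, ‖η‖ ^ 4 * ‖v η‖ ^ 2 :=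
          integral_congr_ae (Eventually.of_forall fun η => by simp only; ring)
      _ ≤ ∫ η, ‖η‖ ^ 4 * ‖v η‖ ^ 2 :=
          setIntegral_le_integral h4 (Eventually.of_forall fun η => by positivity)
  have hI20 : 0 ≤ ∫ η in T, (‖η‖ ^ 2 * ‖v η‖) ^ 2 := integral_nonneg fun η => sq_nonneg _
  calc (∫ η in T, ‖v η‖) ^ 2 = (∫ η in T, (‖η‖ ^ 2)⁻¹ * (‖η‖ ^ 2 * ‖v η‖)) ^ 2 := by
        rw [setIntegral_congr_fun hTm hpt]
    _ ≤ (∫ η in T, (‖η‖ ^ 2)⁻¹ ^ 2) * ∫ η in T, (‖η‖ ^ 2 * ‖v η‖) ^ 2 := hcs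
    _ ≤ (3 * (volume (ball (0 : EuclideanSpace ℝ (Fin 3)) 1)).toReal * ρ⁻¹) *
          ∫ η, ‖η‖ ^ 4 * ‖v η‖ ^ 2 := mul_le_mul hI1 hI2 hI20 (by positivity)

/-! ### The registered stub -/

/-- **stub `stub_agmonL1` — the Fourier-side Agmon inequality.** There is an absolute `K₂ ≥ 0`
(namely `K₂ = (3|B₁|)^{1/2}`) such that for every continuous `v : ℝ³ → ℂ³` with decay of every
order and every `ρ > 0`,
`∫ ‖v‖ ≤ K₂ (ρ^{1/2} Ens^{1/2} + ρ^{-1/2} D^{1/2})`, `Ens = ∫ ‖ξ‖² ∑ₗ ‖vₗ‖²`, `D = ∫ ‖ξ‖⁴ ∑ₗ ‖vₗ‖²`: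
split at radius `ρ`, Cauchy–Schwarz on the ball against `∫_{‖ξ‖<ρ} ‖ξ‖⁻² ≤ 3|B₁| ρ`
(`sq_setIntegral_ball_norm_le`) and on the tail against `∫_{‖ξ‖≥ρ} ‖ξ‖⁻⁴ ≤ 3|B₁|/ρ`
(`sq_setIntegral_tail_norm_le`), then `‖v ξ‖² ≤ ∑ₗ ‖v ξ l‖²`. -/
theorem stub_agmonL1 :
    ∃ K₂ : ℝ, 0 ≤ K₂ ∧ ∀ (v : EuclideanSpace ℝ (Fin 3) → Fin 3 → ℂ), Continuous v →
      (∀ K : ℕ, ∃ A : ℝ, Literature.Analysis.FluidPDE.FourierNS.HasDecay K A v) →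
      ∀ ρ : ℝ, 0 < ρ →
        ∫ ξ, ‖v ξ‖ ≤ K₂ * (ρ ^ (1 / 2 : ℝ) * (∫ ξ, ‖ξ‖ ^ 2 * ∑ l, ‖v ξ l‖ ^ 2) ^ (1 / 2 : ℝ) +
          ρ ^ (-(1 / 2) : ℝ) * (∫ ξ, ‖ξ‖ ^ 4 * ∑ l, ‖v ξ l‖ ^ 2) ^ (1 / 2 : ℝ)) := by
  set CE : ℝ := 3 * (volume (ball (0 : EuclideanSpace ℝ (Fin 3)) 1)).toReal with hCE
  have hCE0 : 0 ≤ CE := by positivity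
  refine ⟨Real.sqrt CE, Real.sqrt_nonneg _, ?_⟩
  intro v hvc hdec ρ hρ
  have h34 : Fintype.card (Fin 3) < 4 := by simp
  obtain ⟨A, hA⟩ := hdec 4
  obtain ⟨A', hA'⟩ := hdec (2 + 4)
  have hvm : AEStronglyMeasurable v volume := hvc.aestronglyMeasurable
  have hvi : Integrable v := hA.integrable (finrank_lt_of_card_lt h34) hvm
  have h4 : Integrable fun η => ‖η‖ ^ 4 * ‖v η‖ ^ 2 :=
    integrable_norm_pow_four_mul_norm_sq_of_hasDecay h34 hA' hvm
  have h2 : Integrable fun η => ‖η‖ ^ 2 * ‖v η‖ ^ 2 :=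
    integrable_norm_sq_mul_norm_sq hvm (integrable_norm_sq_of_hasDecay h34 hA hvm) h4
  set Ens : ℝ := ∫ ξ, ‖ξ‖ ^ 2 * ∑ l, ‖v ξ l‖ ^ 2 with hEns
  set D : ℝ := ∫ ξ, ‖ξ‖ ^ 4 * ∑ l, ‖v ξ l‖ ^ 2 with hD
  -- the sup norm against the componentwise densities
  have hEns_le : ∫ ξ, ‖ξ‖ ^ 2 * ‖v ξ‖ ^ 2 ≤ Ens :=
    integral_mono_of_nonneg (Eventually.of_forall fun ξ => by positivity)
      (integrable_pow_mul_sum_norm_sq hvc h2)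
      (Eventually.of_forall fun ξ =>
        mul_le_mul_of_nonneg_left (pi_norm_sq_le_sum_norm_sq (v ξ)) (by positivity))
  have hD_le : ∫ ξ, ‖ξ‖ ^ 4 * ‖v ξ‖ ^ 2 ≤ D :=
    integral_mono_of_nonneg (Eventually.of_forall fun ξ => by positivity)
      (integrable_pow_mul_sum_norm_sq hvc h4)
      (Eventually.of_forall fun ξ =>
        mul_le_mul_of_nonneg_left (pi_norm_sq_le_sum_norm_sq (v ξ)) (by positivity))
  have hEns0 : 0 ≤ Ens := integral_nonneg fun ξ => by positivity
  have hD0 : 0 ≤ D := integral_nonneg fun ξ => by positivity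
  -- split at the radius `ρ`
  set B := ball (0 : EuclideanSpace ℝ (Fin 3)) ρ with hB
  have hsplit : ∫ ξ, ‖v ξ‖ = (∫ ξ in B, ‖v ξ‖) + ∫ ξ in Bᶜ, ‖v ξ‖ :=
    (integral_add_compl measurableSet_ball hvi.norm).symm
  have hball : (∫ ξ in B, ‖v ξ‖) ^ 2 ≤ (CE * ρ) * Ens :=
    (sq_setIntegral_ball_norm_le hvi h2 hρ).trans
      (mul_le_mul_of_nonneg_left hEns_le (by positivity))
  have htail : (∫ ξ in Bᶜ, ‖v ξ‖) ^ 2 ≤ (CE * ρ⁻¹) * D :=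
    (sq_setIntegral_tail_norm_le hvi h4 hρ).trans
      (mul_le_mul_of_nonneg_left hD_le (by positivity))
  have hball' : ∫ ξ in B, ‖v ξ‖ ≤ Real.sqrt CE * (Real.sqrt ρ * Real.sqrt Ens) := by
    calc ∫ ξ in B, ‖v ξ‖ ≤ Real.sqrt ((CE * ρ) * Ens) := Real.le_sqrt_of_sq_le hball
      _ = Real.sqrt CE * (Real.sqrt ρ * Real.sqrt Ens) := by
          rw [Real.sqrt_mul (by positivity), Real.sqrt_mul hCE0, mul_assoc]
  have htail' : ∫ ξ in Bᶜ, ‖v ξ‖ ≤ Real.sqrt CE * (Real.sqrt ρ⁻¹ * Real.sqrt D) := by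
    calc ∫ ξ in Bᶜ, ‖v ξ‖ ≤ Real.sqrt ((CE * ρ⁻¹) * D) := Real.le_sqrt_of_sq_le htail
      _ = Real.sqrt CE * (Real.sqrt ρ⁻¹ * Real.sqrt D) := by
          rw [Real.sqrt_mul (by positivity), Real.sqrt_mul hCE0, mul_assoc]
  -- square roots as `rpow (1/2)`
  have e2 : ρ ^ (-(1 / 2) : ℝ) = Real.sqrt ρ⁻¹ := by
    rw [Real.rpow_neg hρ.le, ← Real.sqrt_eq_rpow, Real.sqrt_inv]
  rw [e2, ← Real.sqrt_eq_rpow ρ, ← Real.sqrt_eq_rpow Ens, ← Real.sqrt_eq_rpow D, hsplit]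
  calc (∫ ξ in B, ‖v ξ‖) + ∫ ξ in Bᶜ, ‖v ξ‖
      ≤ Real.sqrt CE * (Real.sqrt ρ * Real.sqrt Ens) +
          Real.sqrt CE * (Real.sqrt ρ⁻¹ * Real.sqrt D) := add_le_add hball' htail'
    _ = Real.sqrt CE * (Real.sqrt ρ * Real.sqrt Ens + Real.sqrt ρ⁻¹ * Real.sqrt D) := by ring

end Summit.NavierStokesRegularity.NavierStokesRegularity.Theorems.EnvelopeBound.Leray

end
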